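import Literature.Geometry.Lorentzian.ChartCalculus
import HarnessLib

/-!
# Christoffel maps under a linear change of coordinates

Topic `Geometry/Riemannian` (chart calculus in the `OpensChart` setting of
`Literature.Geometry.Lorentzian.ChartCalculus`). Let `A : V ≃L V'` be a continuous linear
equivalence, `x ∈ U ⊆ V` and `y ∈ U' ⊆ V'` with `A x = y`, and let `g_U`, `g_{U'}` be metrics on
the open sets `U`, `U'` with components `G_U`, `G_{U'}` such that near `x` the components of `g_U`
are the pullback of those of `g_{U'}`: `G_U(v)(u, w) = G_{U'}(A v)(A u, A w)`. Then (second
derivatives of linear maps vanish) the Christoffel maps correspond: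

* `koszulForm_linear_pullback` — `K_x(Y, X, Z) = K'_y(A Y, A X, A Z)`;
* `christoffel_linear_pullback` — **`A (Γ_x(Y)(X)) = Γ'_y(A Y)(A X)`**.

This is the bookkeeping that moves the Christoffel term of Weinstein's ellipsoid
(`TubeChristoffelNearAxis.lean`) to the round picture in which the interior surgery is performed
(the ellipsoid `{‖A v‖ = 1}` becomes the unit sphere).

## References

* B. O'Neill, *Semi-Riemannian Geometry* (1983), Ch. 3, Prop. 13 (Christoffel symbols).
  [cite: ONeill1983, Ch. 3, Prop. 3.13]
* A. Weinstein, Ann. of Math. (2) 87 (1968), 29–41. [cite: Weinstein1968]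

Tags: [ChartCalculus] [ChristoffelSymbols] [Weinstein1968]
-/

noncomputable section

open Bundle Set Function Filter TopologicalSpace
open scoped Manifold ContDiff Topology

namespace Literature.Geometry.Riemannian

open Literature.Geometry.Lorentzian
open Literature.Geometry.Lorentzian.OpensChart
open Literature.Geometry.Lorentzian.PseudoRiemannianMetric

variable {V : Type*} [NormedAddCommGroup V] [NormedSpace ℝ V] [FiniteDimensional ℝ V]
  {V' : Type*} [NormedAddCommGroup V'] [NormedSpace ℝ V'] [FiniteDimensional ℝ V']
  {U : Opens V} {U' : Opens V'} {n n' : ℕ∞ω}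
  {gU : PseudoRiemannianMetric 𝓘(ℝ, V) n V (TangentSpace 𝓘(ℝ, V) : U → Type _)}
  {gU' : PseudoRiemannianMetric 𝓘(ℝ, V') n' V' (TangentSpace 𝓘(ℝ, V') : U' → Type _)}
  {GU : V → V →L[ℝ] V →L[ℝ] ℝ} {GU' : V' → V' →L[ℝ] V' →L[ℝ] ℝ}

omit [FiniteDimensional ℝ V] [FiniteDimensional ℝ V'] in
/-- **The derivative of pulled-back components**: if `G_U(v)(u, w) = G_{U'}(A v)(A u, A w)` near
`x`, then `DG_U(x)(z)(u, w) = DG_{U'}(A x)(A z)(A u, A w)`. [folklore] -/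
theorem fderiv_linear_pullback (A : V ≃L[ℝ] V') {x : V}
    (hpull : ∀ᶠ v in 𝓝 x, ∀ u w : V, GU v u w = GU' (A v) (A u) (A w))
    (hGd : DifferentiableAt ℝ GU x) (hG'd : DifferentiableAt ℝ GU' (A x)) (z u w : V) :
    fderiv ℝ GU x z u w = fderiv ℝ GU' (A x) (A z) (A u) (A w) := by
  rw [← fderiv_apply₂ GU hGd u w z, ← fderiv_apply₂ GU' hG'd (A u) (A w) (A z)]
  -- the scalar component functions agree near `x` up to composition with `A`
  have hev : (fun v ↦ GU v u w) =ᶠ[𝓝 x] fun v ↦ (fun v' ↦ GU' v' (A u) (A w)) (A v) :=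
    hpull.mono fun v hv ↦ hv u w
  rw [hev.fderiv_eq]
  have hsc : DifferentiableAt ℝ (fun v' ↦ GU' v' (A u) (A w)) (A x) :=
    differentiableAt_apply₂ GU' hG'd (A u) (A w)
  have h := hsc.hasFDerivAt.comp x A.hasFDerivAt
  rw [show (fun v ↦ (fun v' ↦ GU' v' (A u) (A w)) (A v)) = ((fun v' ↦ GU' v' (A u) (A w)) ∘ ⇑A)
    from rfl, h.fderiv]
  rfl

omit [FiniteDimensional ℝ V] [FiniteDimensional ℝ V'] in
/-- **The Koszul form of pulled-back components**: `K_x(Y, X, Z) = K'_{Ax}(A Y, A X, A Z)`.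
[cite: ONeill1983, Ch. 3, Prop. 3.13] -/
theorem koszulForm_linear_pullback (A : V ≃L[ℝ] V') {x : V}
    (hpull : ∀ᶠ v in 𝓝 x, ∀ u w : V, GU v u w = GU' (A v) (A u) (A w))
    (hGd : DifferentiableAt ℝ GU x) (hG'd : DifferentiableAt ℝ GU' (A x)) (Y X Z : V) :
    koszulForm GU x Y X Z = koszulForm GU' (A x) (A Y) (A X) (A Z) := by
  simp only [koszulForm_apply, fderiv_linear_pullback A hpull hGd hG'd]

/-- **Christoffel maps under a linear change of coordinates**: with `A x = y` and the components
of `g_U` near `x` the pullback of those of `g_{U'}` under `A` (and `g_U`, `g_{U'}` having these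
components at `x`, `y`), `A (Γ_x(Y)(X)) = Γ'_y(A Y)(A X)`: both pair with `A Z` to
`½ K_x(Y, X, Z) = ½ K'_y(A Y, A X, A Z)` (`two_mul_val_christoffel`, `koszulForm_linear_pullback`),
`A` is onto and `g_{U'}` is nondegenerate. [cite: ONeill1983, Ch. 3, Prop. 3.13] -/
theorem christoffel_linear_pullback (A : V ≃L[ℝ] V') (x : U) (y : U') (hxy : A (x : V) = (y : V'))
    (hG : ∀ a b : V, gU.val x a b = GU (x : V) a b)
    (hG' : ∀ a b : V', gU'.val y a b = GU' (y : V') a b)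
    (hpull : ∀ᶠ v in 𝓝 (x : V), ∀ u w : V, GU v u w = GU' (A v) (A u) (A w))
    (hGd : DifferentiableAt ℝ GU x) (hG'd : DifferentiableAt ℝ GU' y) (Y X : V) :
    A (christoffel gU GU x Y X) = christoffel gU' GU' y (A Y) (A X) := by
  have hG'd' : DifferentiableAt ℝ GU' (A (x : V)) := by rw [hxy]; exact hG'd
  -- pair with `A Z` for an arbitrary `Z`
  have hpair : ∀ Z : V, gU'.val y (A (christoffel gU GU x Y X)) (A Z) =
      gU'.val y (christoffel gU' GU' y (A Y) (A X)) (A Z) := by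
    intro Z
    have h1 := two_mul_val_christoffel (g := gU) (G := GU) x Y X Z
    have h2 := two_mul_val_christoffel (g := gU') (G := GU') y (A Y) (A X) (A Z)
    rw [koszulForm_linear_pullback A hpull hGd hG'd', hxy] at h1
    -- `gU.val x a Z = gU'.val y (A a) (A Z)` at the point
    have h3 : gU.val x (christoffel gU GU x Y X) Z =
        gU'.val y (A (christoffel gU GU x Y X)) (A Z) := by
      rw [hG, hG', hpull.self_of_nhds, hxy]
    linarith
  -- `A Z` exhausts `V'`
  have hall : ∀ Z' : V', gU'.val y (A (christoffel gU GU x Y X) - christoffel gU' GU' y (A Y) (A X))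
      Z' = 0 := by
    intro Z'
    obtain ⟨Z, rfl⟩ := A.surjective Z'
    have e : gU'.val y (A (christoffel gU GU x Y X) - christoffel gU' GU' y (A Y) (A X)) (A Z) =
        gU'.val y (A (christoffel gU GU x Y X)) (A Z) -
          gU'.val y (christoffel gU' GU' y (A Y) (A X)) (A Z) :=
      (gU'.val y).map_sub₂ _ _ _
    rw [e, hpair Z, sub_self]
  exact sub_eq_zero.1 (gU'.nondegenerate y _ hall)

end Literature.Geometry.Riemannian

end
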